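import Summits.CriticalPhenomena.CardyFormulaZ2.Theorems.CardyIKTransportIKLinearTransportScreeningArray

/-!
# Screening estimates for a finite array of independent biased bits, part 2: the flip lemma, `screeningOffset`

Support file (`--supports stmt-CriticalPhenomena-5076`, registered sub-goal `screeningOffset`) for the stub
`stub_Screening` of the line `pinned-diagram-exchange` (crux `IKLinearTransport`); continues part 1
(`…ScreeningArray`: definitions and Walsh coefficients).
* FLIP LEMMA `flip_lemma`: if the data `D q` reads a block `Bk` of entries only through its parity, a parity
  change XOR-ing the data with a fixed pattern `P`, then `|E[G(D q)] - E[G(D q ⊕ P)]| ≤ |∏_{f ∈ Bk} (1 - 2 p_{f.1})|`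
  for every `[0,1]`-valued `G` (write `G(D q) - G(D q ⊕ P) = χ_{Bk}(q) · K(q)` with `K` not reading `Bk`).
* CHAIN `chain_flips`: prefix patterns `[idx ≤ t]`, each costing `≤ ε`, telescope to any pattern `a ∘ idx`
  at cost `≤ L ε`.
* KEY FACT `boxData_block`: a tail region of the box either contains a column block `{n+t} × {r ≥ n+h-1}`
  (iff `i ≤ t`) or misses it; likewise for row blocks; each block has `≥ n` entries, so one flip costs `≤ θ^n`.
* `screeningOffset`: the additive offset `A i ⊕ B j` is absorbed by `≤ w` column flips and `≤ h` row flips.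
-/

namespace Summit.CriticalPhenomena.CardyFormulaZ2.Theorems.IKLinearTransport.PinnedDiagramExchange.ScreeningArray

open Finset

variable {m k : ℕ}

/-! ## Block parities and the flip lemma -/

/-- Parity transport along a block: for `Bk ⊆ S` and `q, q'` agreeing off `Bk`,
`parS S q' = parS S q ⊕ parS Bk q ⊕ parS Bk q'`. -/
theorem parS_of_subset (S Bk : Finset (Fin m × Fin k)) (hBS : Bk ⊆ S) (q q' : Fin m × Fin k → Bool)
    (hqq : ∀ f ∉ Bk, q f = q' f) :
    parS S q' = xor (parS S q) (xor (parS Bk q) (parS Bk q')) := by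
  have hS : ∀ r : Fin m × Fin k → Bool, chiY S r = chiY (S \ Bk) r * chiY Bk r := fun r => by
    unfold chiY
    rw [← Finset.prod_sdiff hBS]
  have hoff : chiY (S \ Bk) q' = chiY (S \ Bk) q :=
    Finset.prod_congr rfl fun f hf => by rw [hqq f (Finset.mem_sdiff.mp hf).2]
  have key : chiY S q' * chiY Bk q = chiY S q * chiY Bk q' := by
    rw [hS q', hS q, hoff]; ring
  simp only [chiY_eq_sgnR_parS] at key
  revert key
  cases parS S q' <;> cases parS S q <;> cases parS Bk q <;> cases parS Bk q' <;> norm_num [sgnR]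

/-- Parity transport off a block: for `Bk` disjoint from `S` and `q, q'` agreeing off `Bk`,
`parS S q' = parS S q`. -/
theorem parS_of_disjoint (S Bk : Finset (Fin m × Fin k)) (hBS : Disjoint Bk S) (q q' : Fin m × Fin k → Bool)
    (hqq : ∀ f ∉ Bk, q f = q' f) : parS S q' = parS S q := by
  unfold parS
  have hS : (S.filter fun f => q' f = true) = S.filter fun f => q f = true :=
    Finset.filter_congr fun f hf => by rw [hqq f (Finset.disjoint_right.mp hBS hf)]
  rw [hS]

/-- FLIP LEMMA. If the data `D q` reads the block `Bk` only through its parity, a parity change XOR-ing the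
data with the fixed pattern `P`, then for every `[0,1]`-valued `G`,
`|E[G(D q)] - E[G(D q ⊕ P)]| ≤ |∏_{f ∈ Bk} (1 - 2 p_{f.1})|`. -/
theorem flip_lemma (p : Fin m → ℝ) (hp : ∀ c, 0 ≤ p c ∧ p c ≤ 1) (Bk : Finset (Fin m × Fin k))
    (f₀ : Fin m × Fin k) (hf₀ : f₀ ∈ Bk) {δ : Type*} (D : (Fin m × Fin k → Bool) → δ → Bool) (P : δ → Bool)
    (hD : ∀ q q' : Fin m × Fin k → Bool, (∀ f ∉ Bk, q f = q' f) →
      D q' = if parS Bk q' = parS Bk q then D q else fun d => xor (D q d) (P d))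
    (G : (δ → Bool) → ℝ) (hG : ∀ x, 0 ≤ G x ∧ G x ≤ 1) :
    |arrSum p (fun q => G (D q)) - arrSum p (fun q => G (fun d => xor (D q d) (P d)))| ≤
      |∏ f ∈ Bk, (1 - 2 * p f.1)| := by
  -- reference configurations: `q` off the block, parity `b` on the block
  set setB : (Fin m × Fin k → Bool) → Bool → (Fin m × Fin k → Bool) :=
    fun q b f => if f = f₀ then b else if f ∈ Bk then false else q f with hsetB
  have hagree : ∀ q b, ∀ f ∉ Bk, q f = setB q b f := by
    intro q b f hf
    have h1 : f ≠ f₀ := fun h => hf (h ▸ hf₀)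
    simp [hsetB, h1, hf]
  have hfilter : ∀ q b, (Bk.filter fun f => setB q b f = true) = if b then {f₀} else ∅ := by
    intro q b
    ext f
    by_cases h1 : f = f₀
    · subst h1
      cases b <;> simp [hsetB, hf₀]
    · by_cases h2 : f ∈ Bk
      · cases b <;> simp [hsetB, h1, h2]
      · cases b <;> simp [hsetB, h1, h2]
  have hpar : ∀ q b, parS Bk (setB q b) = b := by
    intro q b
    unfold parS
    rw [hfilter]
    cases b <;> simp
  have hinv : ∀ f ∈ Bk, ∀ q b v, setB (Function.update q f v) b = setB q b := by
    intro f hf q b v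
    funext f'
    by_cases h1 : f' = f₀
    · simp [hsetB, h1]
    · by_cases h2 : f' ∈ Bk
      · simp [hsetB, h1, h2]
      · have h3 : f' ≠ f := fun h => h2 (h ▸ hf)
        simp [hsetB, h1, h2, Function.update_of_ne h3]
  set K : (Fin m × Fin k → Bool) → ℝ := fun q => G (D (setB q false)) - G (D (setB q true)) with hK
  have hKinv : ∀ f ∈ Bk, ∀ q v, K (Function.update q f v) = K q := by
    intro f hf q v
    simp only [hK, hinv f hf]
  have hK1 : ∀ q, |K q| ≤ 1 := fun q => by
    have h0 := hG (D (setB q false))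
    have h1 := hG (D (setB q true))
    rw [abs_le]
    constructor <;> linarith
  have hpt : ∀ q, G (D q) - G (fun d => xor (D q d) (P d)) = chiY Bk q * K q := by
    intro q
    have h0 := hD q (setB q false) (hagree q false)
    have h1 := hD q (setB q true) (hagree q true)
    rw [hpar] at h0 h1
    rw [chiY_eq_sgnR_parS]
    cases hq : parS Bk q
    · rw [hq] at h0 h1
      simp only [if_true, Bool.true_eq_false, if_false] at h0 h1
      simp [hK, h0, h1, sgnR]
    · rw [hq] at h0 h1
      simp only [if_true, Bool.false_eq_true, if_false] at h0 h1
      simp [hK, h0, h1, sgnR]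
  calc |arrSum p (fun q => G (D q)) - arrSum p (fun q => G (fun d => xor (D q d) (P d)))|
      = |arrSum p (fun q => chiY Bk q * K q)| := by
        rw [arrSum_sub]
        exact congrArg (fun H => |arrSum p H|) (funext hpt)
    _ = |∏ f ∈ Bk, (1 - 2 * p f.1)| * |arrSum p K| := by rw [arrSum_chiY_mul p Bk K hKinv, abs_mul]
    _ ≤ |∏ f ∈ Bk, (1 - 2 * p f.1)| * 1 :=
        mul_le_mul_of_nonneg_left (abs_arrSum_le_one p hp K hK1) (abs_nonneg _)
    _ = |∏ f ∈ Bk, (1 - 2 * p f.1)| := mul_one _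

/-- CHAIN OF FLIPS along prefix patterns: if XOR-ing the pattern `[idx d ≤ t]` costs `≤ ε` for every
`t < L` (uniformly over `[0,1]`-valued observables), then XOR-ing `d ↦ a (idx d)` costs `≤ L ε`
whenever `a` vanishes from `L` on (telescoping `a i = ⊕_{t ≥ i} (a t ⊕ a (t+1))`). -/
theorem chain_flips {δ : Type*} (Φ : ((δ → Bool) → ℝ) → ℝ) (idx : δ → ℕ) (ε : ℝ) (hε : 0 ≤ ε) (L : ℕ)
    (a : ℕ → Bool) (ha : ∀ i, L ≤ i → a i = false)
    (hcost : ∀ t, t < L → ∀ G : (δ → Bool) → ℝ, (∀ x, 0 ≤ G x ∧ G x ≤ 1) →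
      |Φ G - Φ (fun x => G (fun d => xor (x d) (decide (idx d ≤ t))))| ≤ ε)
    (G : (δ → Bool) → ℝ) (hG : ∀ x, 0 ≤ G x ∧ G x ≤ 1) :
    |Φ G - Φ (fun x => G (fun d => xor (x d) (a (idx d))))| ≤ L * ε := by
  -- `pat t d = a (max (idx d) t)` interpolates between `a ∘ idx` (`t = 0`) and `false` (`t = L`)
  suffices H : ∀ j, j ≤ L → ∀ t, t + j = L → ∀ G : (δ → Bool) → ℝ, (∀ x, 0 ≤ G x ∧ G x ≤ 1) →
      |Φ G - Φ (fun x => G (fun d => xor (x d) (a (max (idx d) t))))| ≤ j * ε by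
    have := H L le_rfl 0 (zero_add L) G hG
    simpa using this
  intro j
  induction j with
  | zero =>
    intro _ t ht G _
    have h0 : (fun x => G (fun d => xor (x d) (a (max (idx d) t)))) = G := by
      funext x
      congr 1
      funext d
      rw [ha _ (by omega), Bool.xor_false]
    rw [h0, sub_self, abs_zero]
    simp
  | succ j ih =>
    intro hj t ht G hG
    have ih' := ih (by omega) (t + 1) (by omega) G hG
    by_cases hat : a t = a (t + 1)
    · have hsame : ∀ d, a (max (idx d) t) = a (max (idx d) (t + 1)) := by
        intro d
        by_cases hd : idx d ≤ t
        · rw [max_eq_right hd, max_eq_right (by omega), hat]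
        · rw [max_eq_left (by omega), max_eq_left (by omega)]
      simp only [hsame]
      calc _ ≤ (j : ℝ) * ε := ih'
        _ ≤ (((j + 1 : ℕ)) : ℝ) * ε := by push_cast; nlinarith
    · set G' : (δ → Bool) → ℝ := fun x => G (fun d => xor (x d) (a (max (idx d) (t + 1)))) with hG'
      have hG'01 : ∀ x, 0 ≤ G' x ∧ G' x ≤ 1 := fun x => hG _
      have hc := hcost t (by omega) G' hG'01
      have hstep : (fun x : δ → Bool => G' (fun d => xor (x d) (decide (idx d ≤ t)))) =
          fun x : δ → Bool => G (fun d => xor (x d) (a (max (idx d) t))) := by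
        funext x
        simp only [hG']
        congr 1
        funext d
        by_cases hd : idx d ≤ t
        · rw [max_eq_right hd, max_eq_right (by omega), decide_eq_true hd]
          revert hat
          cases x d <;> cases a t <;> cases a (t + 1) <;> simp
        · rw [max_eq_left (by omega), max_eq_left (by omega), decide_eq_false hd, Bool.xor_false]
      rw [hstep] at hc
      calc |Φ G - Φ (fun x => G (fun d => xor (x d) (a (max (idx d) t))))|
          ≤ |Φ G - Φ G'| + |Φ G' - Φ (fun x => G (fun d => xor (x d) (a (max (idx d) t))))| :=
            abs_sub_le _ _ _
        _ ≤ j * ε + ε := add_le_add ih' hc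
        _ = ((j + 1 : ℕ) : ℝ) * ε := by push_cast; ring

/-! ## Box data: tail parities read blocks only through their parity -/

/-- The tail parity is the parity of the tail region. -/
theorem tailPar_eq_parS (q : Fin m × Fin k → Bool) (i j : ℕ) :
    tailPar q i j = parS (univ.filter fun f : Fin m × Fin k => i ≤ (f.1 : ℕ) ∧ j ≤ (f.2 : ℕ)) q := by
  unfold tailPar parS
  rw [Finset.filter_filter]
  simp only [and_assoc]

/-- KEY FACT ⟹ flip hypothesis: if every tail region of the box either contains the block `Bk` (pattern bit
`true`) or misses it (pattern bit `false`), then changing `q` on `Bk` leaves the box data unchanged when the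
block parity is kept and XORs it with the pattern when the block parity is flipped. -/
theorem boxData_block (n w h : ℕ) (Bk : Finset (Fin m × Fin k)) (P : Fin w × Fin h → Bool)
    (hP : ∀ ij : Fin w × Fin h, ∀ f ∈ Bk,
      (n + (ij.1 : ℕ) ≤ (f.1 : ℕ) ∧ n + (ij.2 : ℕ) ≤ (f.2 : ℕ)) ↔ P ij = true)
    (q q' : Fin m × Fin k → Bool) (hqq : ∀ f ∉ Bk, q f = q' f) :
    boxData n w h q' =
      if parS Bk q' = parS Bk q then boxData n w h q else fun ij => xor (boxData n w h q ij) (P ij) := by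
  have hpt : ∀ ij : Fin w × Fin h,
      boxData n w h q' ij = xor (boxData n w h q ij) (P ij && xor (parS Bk q) (parS Bk q')) := by
    intro ij
    simp only [boxData, tailPar_eq_parS]
    cases hPij : P ij
    · -- the block misses the region
      have hdis : Disjoint Bk (univ.filter fun f : Fin m × Fin k =>
          n + (ij.1 : ℕ) ≤ (f.1 : ℕ) ∧ n + (ij.2 : ℕ) ≤ (f.2 : ℕ)) := by
        rw [Finset.disjoint_left]
        intro f hf hf'
        have h1 := (hP ij f hf).mp (Finset.mem_filter.mp hf').2
        rw [hPij] at h1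
        exact Bool.false_ne_true h1
      rw [parS_of_disjoint _ _ hdis q q' hqq]
      simp
    · -- the block lies inside the region
      have hsub : Bk ⊆ (univ.filter fun f : Fin m × Fin k =>
          n + (ij.1 : ℕ) ≤ (f.1 : ℕ) ∧ n + (ij.2 : ℕ) ≤ (f.2 : ℕ)) := fun f hf =>
        Finset.mem_filter.mpr ⟨mem_univ _, (hP ij f hf).mpr hPij⟩
      rw [parS_of_subset _ _ hsub q q' hqq]
      simp
  split_ifs with hpar
  · funext ij
    rw [hpt ij, hpar]
    simp
  · funext ij
    rw [hpt ij]
    revert hpar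
    cases parS Bk q <;> cases parS Bk q' <;> simp

/-- The column block `{n + t} × {r ≥ n + h - 1}` is contained in the tail region of the box cell `(i, j)`
iff `i ≤ t`, and misses it otherwise. -/
theorem colBlock_pattern (n w h t : ℕ) (ij : Fin w × Fin h) (f : Fin m × Fin k)
    (hf : f ∈ univ.filter fun f : Fin m × Fin k => (f.1 : ℕ) = n + t ∧ n + h - 1 ≤ (f.2 : ℕ)) :
    (n + (ij.1 : ℕ) ≤ (f.1 : ℕ) ∧ n + (ij.2 : ℕ) ≤ (f.2 : ℕ)) ↔ decide ((ij.1 : ℕ) ≤ t) = true := by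
  have h2 := ij.2.2
  obtain ⟨h3, h4⟩ := (Finset.mem_filter.mp hf).2
  simp only [decide_eq_true_eq]
  omega

/-- The row block `{c ≥ n + w - 1} × {n + t}` is contained in the tail region of the box cell `(i, j)`
iff `j ≤ t`, and misses it otherwise. -/
theorem rowBlock_pattern (n w h t : ℕ) (ij : Fin w × Fin h) (f : Fin m × Fin k)
    (hf : f ∈ univ.filter fun f : Fin m × Fin k => (f.2 : ℕ) = n + t ∧ n + w - 1 ≤ (f.1 : ℕ)) :
    (n + (ij.1 : ℕ) ≤ (f.1 : ℕ) ∧ n + (ij.2 : ℕ) ≤ (f.2 : ℕ)) ↔ decide ((ij.2 : ℕ) ≤ t) = true := by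
  have h1 := ij.1.2
  obtain ⟨h3, h4⟩ := (Finset.mem_filter.mp hf).2
  simp only [decide_eq_true_eq]
  omega

/-- The column block has at least `n` entries (it has exactly `n`) on the `(w + 2n - 1) × (h + 2n - 1)` array. -/
theorem colBlock_card (n w h t : ℕ) (hn : 1 ≤ n) (ht : t < w) :
    n ≤ (univ.filter fun f : Fin (w + 2 * n - 1) × Fin (h + 2 * n - 1) =>
      (f.1 : ℕ) = n + t ∧ n + h - 1 ≤ (f.2 : ℕ)).card := by
  let g : Fin n → Fin (w + 2 * n - 1) × Fin (h + 2 * n - 1) :=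
    fun r => (⟨n + t, by omega⟩, ⟨n + h - 1 + r, by omega⟩)
  calc n = (univ : Finset (Fin n)).card := by simp
    _ ≤ _ := by
      refine Finset.card_le_card_of_injOn g (fun r _ => ?_) ?_
      · simp only [Finset.coe_filter, Finset.mem_univ, true_and, Set.mem_setOf_eq, g]
        omega
      · intro a _ b _ hab
        simp only [g, Prod.mk.injEq, Fin.mk.injEq] at hab
        exact Fin.ext (by omega)

/-- The row block has at least `n` entries on the `(w + 2n - 1) × (h + 2n - 1)` array. -/
theorem rowBlock_card (n w h t : ℕ) (hn : 1 ≤ n) (ht : t < h) :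
    n ≤ (univ.filter fun f : Fin (w + 2 * n - 1) × Fin (h + 2 * n - 1) =>
      (f.2 : ℕ) = n + t ∧ n + w - 1 ≤ (f.1 : ℕ)).card := by
  let g : Fin n → Fin (w + 2 * n - 1) × Fin (h + 2 * n - 1) :=
    fun c => (⟨n + w - 1 + c, by omega⟩, ⟨n + t, by omega⟩)
  calc n = (univ : Finset (Fin n)).card := by simp
    _ ≤ _ := by
      refine Finset.card_le_card_of_injOn g (fun r _ => ?_) ?_
      · simp only [Finset.coe_filter, Finset.mem_univ, true_and, Set.mem_setOf_eq, g]
        omega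
      · intro a _ b _ hab
        simp only [g, Prod.mk.injEq, Fin.mk.injEq] at hab
        exact Fin.ext (by omega)

/-- One elementary flip of the box data costs at most `θ ^ n`: columns. -/
theorem colFlip_cost (n w h : ℕ) (hn : 1 ≤ n) (p : Fin (w + 2 * n - 1) → ℝ) (θ : ℝ)
    (hp : ∀ c, 0 ≤ p c ∧ p c ≤ 1) (hθ0 : 0 ≤ θ) (hθ1 : θ ≤ 1) (hpθ : ∀ c, |1 - 2 * p c| ≤ θ)
    (t : ℕ) (ht : t < w) (G : (Fin w × Fin h → Bool) → ℝ) (hG : ∀ x, 0 ≤ G x ∧ G x ≤ 1) :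
    |arrSum (k := h + 2 * n - 1) p (fun q => G (boxData n w h q)) -
        arrSum (k := h + 2 * n - 1) p
          (fun q => G (fun ij => xor (boxData n w h q ij) (decide ((ij.1 : ℕ) ≤ t))))| ≤ θ ^ n := by
  set Bk := (univ.filter fun f : Fin (w + 2 * n - 1) × Fin (h + 2 * n - 1) =>
      (f.1 : ℕ) = n + t ∧ n + h - 1 ≤ (f.2 : ℕ)) with hBk
  have hf₀ : ((⟨n + t, by omega⟩, ⟨n + h - 1, by omega⟩) : Fin (w + 2 * n - 1) × Fin (h + 2 * n - 1)) ∈ Bk :=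
    Finset.mem_filter.mpr ⟨mem_univ _, rfl, le_rfl⟩
  refine le_trans (flip_lemma p hp Bk _ hf₀ (boxData n w h) (fun ij => decide ((ij.1 : ℕ) ≤ t))
    (fun q q' hqq => boxData_block n w h Bk _ (fun ij f hf => colBlock_pattern n w h t ij f hf) q q' hqq) G hG) ?_
  exact abs_prod_bias_le p θ hθ0 hθ1 hpθ Bk n (colBlock_card n w h t hn ht)

/-- One elementary flip of the box data costs at most `θ ^ n`: rows. -/
theorem rowFlip_cost (n w h : ℕ) (hn : 1 ≤ n) (p : Fin (w + 2 * n - 1) → ℝ) (θ : ℝ)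
    (hp : ∀ c, 0 ≤ p c ∧ p c ≤ 1) (hθ0 : 0 ≤ θ) (hθ1 : θ ≤ 1) (hpθ : ∀ c, |1 - 2 * p c| ≤ θ)
    (t : ℕ) (ht : t < h) (G : (Fin w × Fin h → Bool) → ℝ) (hG : ∀ x, 0 ≤ G x ∧ G x ≤ 1) :
    |arrSum (k := h + 2 * n - 1) p (fun q => G (boxData n w h q)) -
        arrSum (k := h + 2 * n - 1) p
          (fun q => G (fun ij => xor (boxData n w h q ij) (decide ((ij.2 : ℕ) ≤ t))))| ≤ θ ^ n := by
  set Bk := (univ.filter fun f : Fin (w + 2 * n - 1) × Fin (h + 2 * n - 1) =>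
      (f.2 : ℕ) = n + t ∧ n + w - 1 ≤ (f.1 : ℕ)) with hBk
  have hf₀ : ((⟨n + w - 1, by omega⟩, ⟨n + t, by omega⟩) : Fin (w + 2 * n - 1) × Fin (h + 2 * n - 1)) ∈ Bk :=
    Finset.mem_filter.mpr ⟨mem_univ _, rfl, le_rfl⟩
  refine le_trans (flip_lemma p hp Bk _ hf₀ (boxData n w h) (fun ij => decide ((ij.2 : ℕ) ≤ t))
    (fun q q' hqq => boxData_block n w h Bk _ (fun ij f hf => rowBlock_pattern n w h t ij f hf) q q' hqq) G hG) ?_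
  exact abs_prod_bias_le p θ hθ0 hθ1 hpθ Bk n (rowBlock_card n w h t hn ht)

/-- REGISTERED SUB-GOAL `screeningOffset` — ADDITIVE OFFSETS ARE ALMOST ABSORBED: on the
`(w + 2n - 1) × (h + 2n - 1)` array, XOR-ing the box data with an additive pattern `A i ⊕ B j` changes the
expectation of a `[0,1]`-valued statistic by at most `(w + h) θ^n`.
Proof: `boxData(i,j) = MM(i,j) ⊕ U(i) ⊕ V(j) ⊕ ζ` with `U(i) = ⊕_{i ≤ c < n+w-1} μ_c`, `μ_c` = parity of the
`n` entries of column `c` in the rows `≥ n+h-1`, `V(j) = ⊕_{j ≤ r < n+h-1} λ_r`, `λ_r` = parity of the `n`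
entries of row `r` in the columns `≥ n+w-1`, `ζ` = parity of the top-right `n × n` block; the offset is
absorbed by `μ_c ↦ μ_c ⊕ A(c) ⊕ A(c+1)`, `λ_r ↦ λ_r ⊕ B(r) ⊕ B(r+1)`, `ζ ↦ ζ ⊕ A(n+w-1) ⊕ B(n+h-1)`; the
data reads those disjoint entry blocks only through these parities, each a parity of `≥ n` independent bits
of bias `≤ θ`, so flipping one of them costs `≤ θ^n` (`|P(even) - P(odd)| = ∏ |1 - 2p| ≤ θ^n`); at most
`(w-1) + (h-1) + 1` flips. [folklore] -/
theorem screeningOffset :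
    ∀ (n w h : ℕ), 1 ≤ n → ∀ (p : Fin (w + 2 * n - 1) → ℝ) (θ : ℝ),
      (∀ c, 0 ≤ p c ∧ p c ≤ 1) → 0 ≤ θ → θ ≤ 1 → (∀ c, |1 - 2 * p c| ≤ θ) →
      ∀ (G : (Fin w × Fin h → Bool) → ℝ), (∀ t, 0 ≤ G t ∧ G t ≤ 1) → ∀ (A : Fin w → Bool) (B : Fin h → Bool),
      |arrSum (k := h + 2 * n - 1) p (fun q => G (boxData n w h q)) -
          arrSum (k := h + 2 * n - 1) p
            (fun q => G (fun ij => xor (boxData n w h q ij) (xor (A ij.1) (B ij.2))))| ≤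
        (w + h) * θ ^ n := by
  intro n w h hn p θ hp hθ0 hθ1 hpθ G hG A B
  set Φ : ((Fin w × Fin h → Bool) → ℝ) → ℝ :=
    fun G => arrSum (k := h + 2 * n - 1) p (fun q => G (boxData n w h q)) with hΦ
  have hε : 0 ≤ θ ^ n := pow_nonneg hθ0 n
  -- column phase
  set a : ℕ → Bool := fun i => if hi : i < w then A ⟨i, hi⟩ else false with ha
  have ha0 : ∀ i, w ≤ i → a i = false := fun i hi => by simp [ha, not_lt.mpr hi]
  have hA := chain_flips Φ (fun ij : Fin w × Fin h => (ij.1 : ℕ)) (θ ^ n) hε w a ha0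
    (fun t ht G' hG' => colFlip_cost n w h hn p θ hp hθ0 hθ1 hpθ t ht G' hG') G hG
  have haA : ∀ ij : Fin w × Fin h, a (ij.1 : ℕ) = A ij.1 := fun ij => by simp [ha, ij.1.2]
  simp only [haA] at hA
  -- row phase
  set G₁ : (Fin w × Fin h → Bool) → ℝ := fun x => G (fun ij => xor (x ij) (A ij.1)) with hG₁
  have hG₁01 : ∀ x, 0 ≤ G₁ x ∧ G₁ x ≤ 1 := fun x => hG _
  set b : ℕ → Bool := fun j => if hj : j < h then B ⟨j, hj⟩ else false with hb
  have hb0 : ∀ j, h ≤ j → b j = false := fun j hj => by simp [hb, not_lt.mpr hj]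
  have hB := chain_flips Φ (fun ij : Fin w × Fin h => (ij.2 : ℕ)) (θ ^ n) hε h b hb0
    (fun t ht G' hG' => rowFlip_cost n w h hn p θ hp hθ0 hθ1 hpθ t ht G' hG') G₁ hG₁01
  have hbB : ∀ ij : Fin w × Fin h, b (ij.2 : ℕ) = B ij.2 := fun ij => by simp [hb, ij.2.2]
  simp only [hbB] at hB
  have hfin : (fun x : Fin w × Fin h → Bool => G₁ (fun ij => xor (x ij) (B ij.2))) =
      fun x => G (fun ij => xor (x ij) (xor (A ij.1) (B ij.2))) := by
    funext x
    simp only [hG₁]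
    congr 1
    funext ij
    cases x ij <;> cases A ij.1 <;> cases B ij.2 <;> rfl
  rw [hfin] at hB
  calc |Φ G - Φ (fun x => G (fun ij => xor (x ij) (xor (A ij.1) (B ij.2))))|
      ≤ |Φ G - Φ G₁| + |Φ G₁ - Φ (fun x => G (fun ij => xor (x ij) (xor (A ij.1) (B ij.2))))| :=
        abs_sub_le _ _ _
    _ ≤ w * θ ^ n + h * θ ^ n := add_le_add hA hB
    _ = (w + h) * θ ^ n := by ring

end Summit.CriticalPhenomena.CardyFormulaZ2.Theorems.IKLinearTransport.PinnedDiagramExchange.ScreeningArray
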